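import Summits.CriticalPhenomena.PercolationContinuityZ3.Theorems.PercNearOneGluingNoHeavyLowerTailSeqExchangeDecisionList
import HarnessLib

/-!
# `NoHeavyLowerTail` (stmt-CriticalPhenomena-4575) — the SHARP sequential inequalities S2♯ and S3♯

Support file (hull-port / coupling seat `prim-hp-1` gen 10; `--supports stmt-CriticalPhenomena-4575`).
No definitions, no named facts, no sorries.  Memo HULLPORT-COUPLING.md §51(a).

For pairs `e_i = s(v_i,u_i)` and a vertex `a` dominated by the `v_i` (`μ(a ↔ b) ≤ μ(v_i ↔ b)`):
* `SeqExchange.seq_two_sharp` (S2♯):  `μ(v₂; ē₁e₂) − μ(a; ē₁e₂) ≥ −(w e₂)·[μ(v₁; e₁) − μ(a; e₁)]`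
  — deleting `e₁` costs the anchor `v₂` (on its own open cell) at most `w e₂` times the Lemma-3(i) slack of `v₁`;
  the plain two-edge sequential lemma (`seq_two`) has the factor `1`.  Proof: `switching` bounds the domination gap in
  `w[e₁ ↦ 0]` by the slack of `v₁`; Lemma 3(i) with slack in `w[e₁ ↦ 0]` carries the factor `w e₂`.
* `SeqExchange.seq_three_sharp` (S3♯):  `μ(v₃; ē₁ē₂e₃) − μ(a; ē₁ē₂e₃) ≥ −(w e₃)·([μ(v₁;e₁) − μ(a;e₁)] + [μ(v₂;ē₁e₂) − μ(a;ē₁e₂)])`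
  — from `double_deletion_deficit` and Lemma 3(i) with slack in `w[e₁ ↦ 0][e₂ ↦ 0]`.
These are the inequalities under which the tournament certificate for three dangerous pairs was tested (memo §51).
[cite: KozmaNitzan2024, Lemma 3(i) (pp. 6–7), Lemma 5 (p. 13); this work (memo HULLPORT-COUPLING.md §51(a))]
-/

namespace Summit.CriticalPhenomena.PercolationContinuityZ3.Theorems

open MeasureTheory Set
open Literature.Probability.LatticeModels
open Literature.Probability.Percolation

noncomputable section
open Classical

namespace SeqExchange

variable {n : ℕ}

/-- **S2♯.**  Non-loop pairs `e₁ = s(v₁,u₁)`, `e₂ = s(v₂,u₂)`, `a ≤ v₁`, `a ≤ v₂`.  Then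
`μ(a ↔ b, e₁ closed, e₂ open) − μ(v₂ ↔ b, e₁ closed, e₂ open) ≤ (w e₂)·(μ(v₁ ↔ b, e₁ open) − μ(a ↔ b, e₁ open))`.
[cite: KozmaNitzan2024, Lemma 3(i), Lemma 5; this work (memo §51(a))] -/
theorem seq_two_sharp (w : Sym2 (Fin n) → unitInterval) (a v₁ u₁ v₂ u₂ b : Fin n) (h₁ne : v₁ ≠ u₁)
    (h₂ne : v₂ ≠ u₂)
    (h₁ : (prodBernoulli w).real (openConn a b) ≤ (prodBernoulli w).real (openConn v₁ b))
    (h₂ : (prodBernoulli w).real (openConn a b) ≤ (prodBernoulli w).real (openConn v₂ b)) :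
    (prodBernoulli w).real (openConn a b ∩ {ω | s(v₁, u₁) ∉ ω} ∩ {ω | s(v₂, u₂) ∈ ω}) -
        (prodBernoulli w).real (openConn v₂ b ∩ {ω | s(v₁, u₁) ∉ ω} ∩ {ω | s(v₂, u₂) ∈ ω}) ≤
      (w s(v₂, u₂) : ℝ) *
        ((prodBernoulli w).real (openConn v₁ b ∩ {ω | s(v₁, u₁) ∈ ω}) -
          (prodBernoulli w).real (openConn a b ∩ {ω | s(v₁, u₁) ∈ ω})) := by
  set μ := prodBernoulli w with hμ
  set e₁ : Sym2 (Fin n) := s(v₁, u₁) with he₁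
  set e₂ : Sym2 (Fin n) := s(v₂, u₂) with he₂
  set w₀ : Sym2 (Fin n) → unitInterval := Function.update w e₁ 0 with hw₀
  set μ₀ := prodBernoulli w₀ with hμ₀
  have hρ0 : 0 ≤ (w e₁ : ℝ) := (w e₁).2.1
  have hρ1 : (w e₁ : ℝ) ≤ 1 := (w e₁).2.2
  have hσ0 : 0 ≤ (w₀ e₂ : ℝ) := (w₀ e₂).2.1
  set s₁ : ℝ := μ.real (openConn v₁ b ∩ {ω | e₁ ∈ ω}) - μ.real (openConn a b ∩ {ω | e₁ ∈ ω}) with hs₁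
  have hs₁0 : 0 ≤ s₁ := by
    have := lemma3i_pair w a v₁ u₁ b h₁ne le_rfl (by rw [add_zero]; exact h₁)
    rw [hs₁]; linarith
  -- the gap in `w₀`
  have hgap : (1 - (w e₁ : ℝ)) * (μ₀.real (openConn a b) - μ₀.real (openConn v₂ b)) ≤ s₁ := by
    have := gap_after_delete w a v₁ u₁ v₂ b h₁ne (δ₁ := 0) (δ := 0) (by rw [add_zero]; exact h₁)
      (by rw [add_zero]; exact h₂)
    have hm : max (0 : ℝ) 0 = 0 := max_self 0
    rw [hm, add_zero] at this
    rw [hs₁]; exact this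
  -- Lemma 3(i) with slack in `w₀`
  set δ' : ℝ := max 0 (μ₀.real (openConn a b) - μ₀.real (openConn v₂ b)) with hδ'
  have hδ'0 : 0 ≤ δ' := le_max_left _ _
  have hδ'h : μ₀.real (openConn a b) ≤ μ₀.real (openConn v₂ b) + δ' := by
    have := le_max_right 0 (μ₀.real (openConn a b) - μ₀.real (openConn v₂ b))
    rw [← hδ'] at this; linarith
  have step2 := lemma3i_pair w₀ a v₂ u₂ b h₂ne hδ'0 hδ'h
  rw [real_setOf_mem] at step2
  have hgap' : (1 - (w e₁ : ℝ)) * δ' ≤ s₁ := by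
    rcases le_total 0 (μ₀.real (openConn a b) - μ₀.real (openConn v₂ b)) with hpos | hneg
    · rw [hδ', max_eq_right hpos]; exact hgap
    · rw [hδ', max_eq_left hneg, mul_zero]; exact hs₁0
  -- `w₀ e₂ = w e₂` unless `e₂ = e₁` (then both sides concern the same pair; the factor is `0`)
  have hA : μ.real (openConn a b ∩ {ω | e₁ ∉ ω} ∩ {ω | e₂ ∈ ω}) =
      (1 - (w e₁ : ℝ)) * μ₀.real (openConn a b ∩ {ω | e₂ ∈ ω}) := real_inter_notMem_inter w e₁ _ _
  have hV : μ.real (openConn v₂ b ∩ {ω | e₁ ∉ ω} ∩ {ω | e₂ ∈ ω}) =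
      (1 - (w e₁ : ℝ)) * μ₀.real (openConn v₂ b ∩ {ω | e₂ ∈ ω}) := real_inter_notMem_inter w e₁ _ _
  by_cases heq : e₂ = e₁
  · -- then `{e₁ ∉ ω} ∩ {e₂ ∈ ω} = ∅`
    have hempty : ∀ y : Fin n, μ.real (openConn y b ∩ {ω | e₁ ∉ ω} ∩ {ω | e₂ ∈ ω}) = 0 := by
      intro y
      have : openConn y b ∩ {ω : BondConfig (Fin n) | e₁ ∉ ω} ∩ {ω | e₂ ∈ ω} = ∅ := by
        ext ω; simp only [mem_inter_iff, mem_setOf_eq, mem_empty_iff_false, iff_false, not_and, heq]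
        exact fun h => h.2
      rw [this, measureReal_empty]
    rw [hempty, hempty, sub_self]
    exact mul_nonneg (w e₂).2.1 hs₁0
  · have hw₀e₂ : (w₀ e₂ : ℝ) = (w e₂ : ℝ) := by rw [hw₀, Function.update_of_ne heq]
    rw [hA, hV]
    have h1 : (1 - (w e₁ : ℝ)) * (μ₀.real (openConn a b ∩ {ω | e₂ ∈ ω}) -
        μ₀.real (openConn v₂ b ∩ {ω | e₂ ∈ ω})) ≤ (1 - (w e₁ : ℝ)) * (δ' * (w₀ e₂ : ℝ)) :=
      mul_le_mul_of_nonneg_left (by linarith) (by linarith)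
    have h2 : (1 - (w e₁ : ℝ)) * (δ' * (w₀ e₂ : ℝ)) ≤ s₁ * (w e₂ : ℝ) := by
      rw [← mul_assoc, hw₀e₂]
      exact mul_le_mul_of_nonneg_right hgap' (w e₂).2.1
    nlinarith [h1, h2]

/-- **S3♯.**  Non-loop pairs `e_i = s(v_i,u_i)` (`i = 1,2,3`), `a ≤ v₁, v₂, v₃`.  Then
`μ(a; ē₁ē₂e₃) − μ(v₃; ē₁ē₂e₃) ≤ (w e₃)·([μ(v₁;e₁) − μ(a;e₁)] + [μ(v₂;ē₁e₂) − μ(a;ē₁e₂)])`.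
[cite: KozmaNitzan2024, Lemma 3(i), Lemma 5; this work (memo §51(a))] -/
theorem seq_three_sharp (w : Sym2 (Fin n) → unitInterval) (a v₁ u₁ v₂ u₂ v₃ u₃ b : Fin n)
    (h₁ne : v₁ ≠ u₁) (h₂ne : v₂ ≠ u₂) (h₃ne : v₃ ≠ u₃)
    (h₁ : (prodBernoulli w).real (openConn a b) ≤ (prodBernoulli w).real (openConn v₁ b))
    (h₂ : (prodBernoulli w).real (openConn a b) ≤ (prodBernoulli w).real (openConn v₂ b))
    (h₃ : (prodBernoulli w).real (openConn a b) ≤ (prodBernoulli w).real (openConn v₃ b)) :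
    (prodBernoulli w).real (openConn a b ∩ {ω | s(v₁, u₁) ∉ ω} ∩ {ω | s(v₂, u₂) ∉ ω} ∩ {ω | s(v₃, u₃) ∈ ω}) -
        (prodBernoulli w).real
          (openConn v₃ b ∩ {ω | s(v₁, u₁) ∉ ω} ∩ {ω | s(v₂, u₂) ∉ ω} ∩ {ω | s(v₃, u₃) ∈ ω}) ≤
      (w s(v₃, u₃) : ℝ) *
        (((prodBernoulli w).real (openConn v₁ b ∩ {ω | s(v₁, u₁) ∈ ω}) -
            (prodBernoulli w).real (openConn a b ∩ {ω | s(v₁, u₁) ∈ ω})) +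
          ((prodBernoulli w).real (openConn v₂ b ∩ {ω | s(v₁, u₁) ∉ ω} ∩ {ω | s(v₂, u₂) ∈ ω}) -
            (prodBernoulli w).real (openConn a b ∩ {ω | s(v₁, u₁) ∉ ω} ∩ {ω | s(v₂, u₂) ∈ ω}))) := by
  set μ := prodBernoulli w with hμ
  set e₁ : Sym2 (Fin n) := s(v₁, u₁) with he₁
  set e₂ : Sym2 (Fin n) := s(v₂, u₂) with he₂
  set e₃ : Sym2 (Fin n) := s(v₃, u₃) with he₃
  -- the double-deletion deficit `D ≤ S := s₁ + t₂₁`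
  have hdef := double_deletion_deficit w a v₁ u₁ v₂ u₂ v₃ b h₁ne h₂ne h₁ h₂ h₃
  set S : ℝ := (μ.real (openConn v₁ b ∩ {ω | e₁ ∈ ω}) - μ.real (openConn a b ∩ {ω | e₁ ∈ ω})) +
    (μ.real (openConn v₂ b ∩ {ω | e₁ ∉ ω} ∩ {ω | e₂ ∈ ω}) -
      μ.real (openConn a b ∩ {ω | e₁ ∉ ω} ∩ {ω | e₂ ∈ ω})) with hS
  -- the doubly deleted graph
  set w₁ : Sym2 (Fin n) → unitInterval := Function.update w e₁ 0 with hw₁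
  set w₂ : Sym2 (Fin n) → unitInterval := Function.update w₁ e₂ 0 with hw₂
  set μ₂ := prodBernoulli w₂ with hμ₂
  have hc₁0 : 0 ≤ 1 - (w e₁ : ℝ) := by linarith [(w e₁).2.2]
  have hc₂0 : 0 ≤ 1 - (w₁ e₂ : ℝ) := by linarith [(w₁ e₂).2.2]
  set c : ℝ := (1 - (w e₁ : ℝ)) * (1 - (w₁ e₂ : ℝ)) with hc
  have hc0 : 0 ≤ c := mul_nonneg hc₁0 hc₂0
  -- factorisation of the doubly closed cells
  have hfac : ∀ (Y : Set (BondConfig (Fin n))),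
      μ.real (Y ∩ {ω | e₁ ∉ ω} ∩ {ω | e₂ ∉ ω}) = c * μ₂.real Y := by
    intro Y
    rw [real_inter_notMem_inter w e₁ Y {ω | e₂ ∉ ω}, goodStepEI_real_inter_closed_eq w₁ e₂ Y, hc, mul_assoc]
  have hfac3 : ∀ (Y : Set (BondConfig (Fin n))),
      μ.real (Y ∩ {ω | e₁ ∉ ω} ∩ {ω | e₂ ∉ ω} ∩ {ω | e₃ ∈ ω}) = c * μ₂.real (Y ∩ {ω | e₃ ∈ ω}) := by
    intro Y
    rw [Set.inter_right_comm (Y ∩ {ω | e₁ ∉ ω}) {ω | e₂ ∉ ω} {ω | e₃ ∈ ω},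
      Set.inter_right_comm Y {ω | e₁ ∉ ω} {ω | e₃ ∈ ω}]
    rw [show Y ∩ {ω : BondConfig (Fin n) | e₃ ∈ ω} ∩ {ω | e₁ ∉ ω} ∩ {ω | e₂ ∉ ω} =
      (Y ∩ {ω | e₃ ∈ ω}) ∩ {ω | e₁ ∉ ω} ∩ {ω | e₂ ∉ ω} from rfl]
    exact hfac _
  -- the deficit in `μ₂`
  have hD : c * (μ₂.real (openConn a b) - μ₂.real (openConn v₃ b)) ≤ S := by
    have h1 := hfac (openConn a b)
    have h2 := hfac (openConn v₃ b)
    rw [hS]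
    have : μ.real (openConn a b ∩ {ω | e₁ ∉ ω} ∩ {ω | e₂ ∉ ω}) -
        μ.real (openConn v₃ b ∩ {ω | e₁ ∉ ω} ∩ {ω | e₂ ∉ ω}) ≤ S := by rw [hS]; exact hdef
    rw [h1, h2] at this; linarith
  have hS0 : 0 ≤ S ∨ c = 0 := by
    by_cases hcz : c = 0
    · exact Or.inr hcz
    · left
      -- `S ≥ c·(μ₂(a) − μ₂(v₃))` is not enough; use `s₁ ≥ 0` and `t₂₁ ≥ -s₁` (seq_two)
      have hseq := seq_two w a v₁ u₁ v₂ u₂ b h₁ne h₂ne (δ₁ := 0) (δ₂ := 0) le_rfl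
        (by rw [add_zero]; exact h₁) (by rw [add_zero]; exact h₂)
      have hm : max (0 : ℝ) 0 = 0 := max_self 0
      rw [hm, add_zero] at hseq
      rw [hS]; linarith
  -- Lemma 3(i) with slack in `w₂`
  set δ' : ℝ := max 0 (μ₂.real (openConn a b) - μ₂.real (openConn v₃ b)) with hδ'
  have hδ'0 : 0 ≤ δ' := le_max_left _ _
  have hδ'h : μ₂.real (openConn a b) ≤ μ₂.real (openConn v₃ b) + δ' := by
    have := le_max_right 0 (μ₂.real (openConn a b) - μ₂.real (openConn v₃ b))
    rw [← hδ'] at this; linarith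
  have step := lemma3i_pair w₂ a v₃ u₃ b h₃ne hδ'0 hδ'h
  rw [real_setOf_mem] at step
  have hcδ : c * δ' ≤ S := by
    rcases le_total 0 (μ₂.real (openConn a b) - μ₂.real (openConn v₃ b)) with hpos | hneg
    · rw [hδ', max_eq_right hpos]; exact hD
    · rw [hδ', max_eq_left hneg, mul_zero]
      rcases hS0 with h | h
      · exact h
      · -- c = 0: then the closed cells vanish and S ≥ deficit = 0·… ; still need S ≥ 0: from hD with c = 0
        have : (0 : ℝ) ≤ S := by
          have := hD; rw [h, zero_mul] at this; exact this
        exact this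
  have hSnn : 0 ≤ S := by
    rcases hS0 with h | h
    · exact h
    · have := hD; rw [h, zero_mul] at this; exact this
  have hSw : 0 ≤ (w e₃ : ℝ) * S := mul_nonneg (w e₃).2.1 hSnn
  -- `w₂ e₃` versus `w e₃`
  rw [hfac3 (openConn a b), hfac3 (openConn v₃ b)]
  by_cases h31 : e₃ = e₁
  · -- then `{e₁ ∉ ω} ∩ {e₃ ∈ ω}`-cells vanish: both sides' left factor is `0`-measure… handle via w₂ e₃ = 0
    have hw₂e₃ : (w₂ e₃ : ℝ) = 0 := by
      rw [hw₂]
      by_cases h32 : e₃ = e₂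
      · rw [h32, Function.update_self]; rfl
      · rw [Function.update_of_ne h32, hw₁, h31, Function.update_self]; rfl
    have hz : μ₂.real (openConn a b ∩ {ω | e₃ ∈ ω}) - μ₂.real (openConn v₃ b ∩ {ω | e₃ ∈ ω}) ≤ 0 := by
      rw [hw₂e₃, mul_zero, add_zero] at step; linarith
    nlinarith [hz, hc0, hSw]
  · by_cases h32 : e₃ = e₂
    · have hw₂e₃ : (w₂ e₃ : ℝ) = 0 := by rw [hw₂, h32, Function.update_self]; rfl
      have hz : μ₂.real (openConn a b ∩ {ω | e₃ ∈ ω}) - μ₂.real (openConn v₃ b ∩ {ω | e₃ ∈ ω}) ≤ 0 := by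
        rw [hw₂e₃, mul_zero, add_zero] at step; linarith
      nlinarith [hz, hc0, hSw]
    · have hw₂e₃ : (w₂ e₃ : ℝ) = (w e₃ : ℝ) := by
        rw [hw₂, Function.update_of_ne h32, hw₁, Function.update_of_ne h31]
      rw [hw₂e₃] at step
      have h1 : c * (μ₂.real (openConn a b ∩ {ω | e₃ ∈ ω}) - μ₂.real (openConn v₃ b ∩ {ω | e₃ ∈ ω})) ≤
          c * (δ' * (w e₃ : ℝ)) := mul_le_mul_of_nonneg_left (by linarith) hc0
      have h2 : c * (δ' * (w e₃ : ℝ)) ≤ S * (w e₃ : ℝ) := by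
        rw [← mul_assoc]; exact mul_le_mul_of_nonneg_right hcδ (w e₃).2.1
      nlinarith [h1, h2]

end SeqExchange

end

end Summit.CriticalPhenomena.PercolationContinuityZ3.Theorems
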